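/-
Copyright (c) 2026 the pub-hodgecm-mathlib formalisation cell (harness21).  Prover seat hodgecm-mathlib-LH7-p07 (g0), Track A «(D-RAM) FOUR-FRAME» squad, helper lane on
h413 = stmt-HodgeConjecture-24833 (count-neutral).  β-BOARD v1, row R8-EQ-a (LH7-p05 (g0) 21:31:28Z (B) «LOCUS SUMS»): the `e = 0` twins of ★ p862097 — the three slot sums
over the glue classes of the equilateral key ON THE LOCUS vanish.  2026-09-04.
-/
import Summits.HodgeConjecture.HodgeConjecture.Theorems.F0P3cDyRamGlueWindowVanishingUnit   -- ★ p862097 (this seat): `v_sub_le_and_of_v_linear_sub_le_unit`; brings ★ p861670 `image_repr`, ★ p861614 `image_sub_one_repr`, ★ p861409 `sum_eq_zero_of_classIsometry_flip`, `normSign_eq_of_rel_near`, ★ `normSign_mul_norm`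
import HarnessLib

/-!
# Crux `H413`, line LH4 «(D-RAM) FOUR-FRAME» — β-BOARD R8-EQ-a «LOCUS SUMS»: THE `e = 0` TWINS OF ★ p862097 — `ω(r + c₀)`, `ω(r(r + c₀))`, `ω((1 + r)(r + c₀))` sum to zero
# over every complete irredundant system of `T = {σr = r, |r| = 1, |1 + r| = 1, |r + c₀| = 1}` (`c₀` a fixed unit with `|1 − c₀| = 1`), hence the three double sums
# `Σ_{g ∈ R, |1+g| = 1, |g+c₀| = 1} Σ_{aβ ∈ Aβ} G_i(g + (1+g)(aβ − 1)) = 0` over the fixed UNITS `R` modulo `𝔭ⁿ`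

Cell `hodgecm-mathlib` (D-0151), FLOOR 0, crux item H413 = `stmt-HodgeConjecture-24833`, route `HCCMUnconditional`; squad F0∕P3c∕LH4 (this seat re-dealt from F0∕P3c∕LH7).
THEOREMS ONLY (no `def`, no instance, no notation, no `sorry`, default heartbeats); ★-only imports; lane `--supports stmt-HodgeConjecture-24833 --as helper` (count-neutral);
pays NO row, states NO law.

WHY (LH7-p05 (g0), 2026-09-04 21:31:28Z, R8-EQ-a = the equilateral key `n₁ = n₂ = n₃ = m` ON THE LOCUS `2ρ + ℓ₀ = m`).  There the stratum is in the tube regime, the admissible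
glue reps are the fixed units `g` with `|1 + g| = 1`, the clean shell cuts `|g + c₀| = 1` (`c₀ = g_β∕g_α`, a fixed unit with `1 − c₀` a unit), and the per-representative head is a
class sign times `G₁ = ω(r + c₀)`, `G₀ = ω(r(r + c₀))` or `G₂ = ω((1 + r)(r + c₀))` at `r = g + (1+g)(aβ − 1)` — ★ p862097's letters with the cut exponent `e = 0`, where its
hypothesis `1 ≤ e` fails (it made `1 + g` a unit from `|1 − c₀| = 1`; at `e = 0` the admissibility `|1 + g| = 1` is part of the cut instead).  MECHANISM (no inclusion–exclusion):
the set `T(p, q) = {σr = r, |r| = 1, |r + p| = 1, |r + q| = 1}` (`|p|, |q| ≤ 1`, `σp = p`) is STABLE under the flip `r ↦ c·(r + p) − p` by the ★ non-norm fixed unit `c`,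
`|c − 1| ≤ |ϖ|^{2d−2} < 1` (it fixes every residue class modulo `𝔭`), which is a class-isometry reversing `ω(r + p)`; so `Σ_{system} ω(r + p) = 0` (§1, engine ★ p861409).
`G₁`: `(p, q) = (c₀, 1)`.  `G₀`: `r(r + c₀) = (1 + c₀r⁻¹)·r²` (`r²` a norm), and `u = c₀r⁻¹` is a class-isometric involution of `T` — `(p, q) = (1, c₀)`.  `G₂`: `(1 + r)(r + c₀) =
(1 − (1 − c₀)(1 + r)⁻¹)·(1 + r)²`, and `u = (1 − c₀)(1 + r)⁻¹` carries `T` class-isometrically onto `T(−1, −(1 − c₀))`, `ω(1 − u) = ω(−1)·ω(u − 1)` — `(p, q) = (−1, −(1 − c₀))`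
(transports ★ p861670 `image_repr`).  The `(g, aβ) ↦ r` linearisation is ★ p862097's with `|1 + g| = 1` read from the cut.
WHAT IS PROVED (letters: `σc₀ = c₀`, `|c₀| = 1`, `|1 − c₀| = 1`; `R` a complete irredundant system modulo `𝔭ⁿ` of the fixed UNITS; `Aβ` and `n ≤ 2M`, `2M ≤ k + d ≤ 2M + 1`,
`d ≤ M ≤ k` VERBATIM as ★ p861670∕p862097; `1 ≤ n`, `2d − 1 ≤ 2M`; the cut `|1 + g| = 1 ∧ |g + c₀| = 1`).
* §1 **`sum_normSign_add_eq_zero_of_twoPoint`** — `Σ_{system of T(p,q) mod 𝔭^N} ω(r + p) = 0` (`2 ≤ d`, `2d − 1 ≤ N`).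
* §2 algebra `mul_add_eq_norm_mul`, `one_add_mul_add_eq_norm_mul`; the three slot sums over any system `Sh` of `T` modulo `𝔭^N`: **`sum_normSign_add_shell_eq_zero_locus`**,
  **`sum_normSign_mul_add_shell_eq_zero_locus`**, **`sum_normSign_one_add_mul_add_shell_eq_zero_locus`**.
* §3 the `e = 0` linearisation (`glueShell_image_sub_locus ∕ _complete_locus ∕ _irredundant_locus`, `glueShell_injOn_locus`, `sum_sum_glueShell_eq_sum_image_locus`) and
  **`sum_filter_sum_eq_zero_of_shell_locus`**.
* §4 HEADS in ★ p862097's binder order with `(he) (hen) (heM)` replaced by `(hn : 1 ≤ n) (hdM2 : 2d − 1 ≤ 2M)` and the filter `fun g => |1 + g| = 1 ∧ |g + c₀| = 1`: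
  **`sum_filter_sum_normSign_add_eq_zero_locus`** (`G₁`), **`sum_filter_sum_normSign_mul_add_eq_zero_locus`** (`G₀`), **`sum_filter_sum_normSign_one_add_mul_add_eq_zero_locus`** (`G₂`).
HONEST LABEL.  Finite character sums over a valuation ring; count-neutral (`--supports`); pays no registered stub, touches no `Lines/` module, states no census law; R8-EQ, `hEqW`,
`hRest`, (β-BAL), (β), T₊ remain OPEN; `HC_CM` is proved only modulo the 7 printed citations (2 remaining named inputs: hLiu418 = `stmt-HodgeConjecture-24832`, h413 =
`stmt-HodgeConjecture-24833`) until rung 0 closes.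

## References
* [Serre1979] J.-P. Serre, *Local Fields*, GTM 67 (1979), Ch. II §1 (residue systems), Ch. V §3 Cor. 3 (norm groups of ramified quadratic extensions), Ch. XV §2 (norm residue symbol).
* [IrelandRosen1990] K. Ireland, M. Rosen, *A Classical Introduction to Modern Number Theory*, GTM 84 (1990), Ch. 8 §3 (vanishing of twisted multiplicative character sums).
-/

set_option autoImplicit false

namespace Summit.HodgeConjecture.HodgeConjecture.Cruxes.H413.F0P3cDyRamGlueWindowVanishingLocus

open WithZero
open scoped Valued
open Literature.NumberTheory.Automorphic.UnitaryThreeFourFrame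
open Literature.NumberTheory.LocalFields.WildQuadraticDatum
open Summit.HodgeConjecture.HodgeConjecture.Cruxes.H413.F0P3cDyRamGlueShellLinearisation (v_pow_le_pow_iff v_pow_lt_pow_iff)
open Summit.HodgeConjecture.HodgeConjecture.Cruxes.H413.F0P3cDyRamGlueWindowSum (image_sub_one_repr)
open Summit.HodgeConjecture.HodgeConjecture.Cruxes.H413.F0P3cDyRamGlueClassCharSums
open Summit.HodgeConjecture.HodgeConjecture.Cruxes.H413.F0P3cDyRamGlueWindowVanishing (image_repr)
open Summit.HodgeConjecture.HodgeConjecture.Cruxes.H413.F0P3cDyRamGlueWindowVanishingUnit (v_sub_le_and_of_v_linear_sub_le_unit)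
open Summit.HodgeConjecture.HodgeConjecture.Cruxes.H413.F0P3cDyRamFixedCountDiagonalModel (normSign_mul_norm)

variable {K : Type} [Field K] [Valued K ℤᵐ⁰] {σ : K →+* K} {ϖ : K} {d t : ℕ}

/-! ## §1  The two-point flip: `Σ ω(r + p) = 0` over a system of `{σr = r, |r| = 1, |r + p| = 1, |r + q| = 1}` -/

/-- **THE TWO-POINT FLIP**: for `|p| ≤ 1` fixed and `|q| ≤ 1`, over a complete irredundant system modulo `𝔭^N` (`2 ≤ d`, `2d − 1 ≤ N`) of
`T(p, q) = {σr = r, |r| = 1, |r + p| = 1, |r + q| = 1}`, `Σ ω(r + p) = 0`: the flip `r ↦ c(r + p) − p` (`c` the ★ non-norm fixed unit, `|c − 1| < 1`) preserves `T(p, q)`, is a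
class-isometry, and reverses `ω(r + p)`. [cite: Serre1979, Ch. V §3 Cor. 3; Ch. XV §2] -/
theorem sum_normSign_add_eq_zero_of_twoPoint [CompleteSpace K] [Finite 𝓀[K]] (hD : IsRamifiedQuadraticDatum σ ϖ d t) (h2v : Valued.v (2 : K) < 1) (h2d : 2 ≤ d)
    {p q : K} (hσp : σ p = p) (hp : Valued.v p ≤ 1) (hq : Valued.v q ≤ 1) {N : ℕ} (hN : 2 * d - 1 ≤ N) (S : Finset K)
    (hS1 : ∀ r ∈ S, σ r = r ∧ Valued.v r = 1 ∧ Valued.v (r + p) = 1 ∧ Valued.v (r + q) = 1)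
    (hS2 : ∀ r : K, σ r = r → Valued.v r = 1 → Valued.v (r + p) = 1 → Valued.v (r + q) = 1 → ∃ x ∈ S, Valued.v (r - x) ≤ Valued.v ϖ ^ N)
    (hS3 : ∀ x ∈ S, ∀ x' ∈ S, Valued.v (x - x') ≤ Valued.v ϖ ^ N → x = x') :
    ∑ r ∈ S, normSign σ (r + p) = 0 := by
  obtain ⟨-, -, hϖ, -, -, -, -⟩ := id hD
  obtain ⟨c, hσc, hc1, hcd, hcn⟩ := exists_fixed_unit_not_norm_v_sub_one_le hD h2v
  have hc1lt : Valued.v (c - 1) < 1 := lt_of_le_of_lt hcd (by rw [← exp_zero, exp_lt_exp]; omega)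
  -- `|c·x + (c − 1)·y| = 1` whenever `|x| = 1`, `|y| ≤ 1`
  have hkey : ∀ x y : K, Valued.v x = 1 → Valued.v y ≤ 1 → Valued.v (c * x + (c - 1) * y) = 1 := fun x y hx hy => by
    rw [Valuation.map_add_eq_of_lt_left _ ?_, map_mul, hc1, hx, one_mul]
    rw [map_mul, map_mul, hc1, hx, one_mul]
    exact mul_lt_one_of_nonneg_of_lt_one_left zero_le hc1lt hy
  refine sum_eq_zero_of_classIsometry_flip (A := {r : K | σ r = r ∧ Valued.v r = 1 ∧ Valued.v (r + p) = 1 ∧ Valued.v (r + q) = 1}) S hS1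
    (fun r hr => hS2 r hr.1 hr.2.1 hr.2.2.1 hr.2.2.2) hS3 (fun r => c * (r + p) - p) ?_ ?_ (fun r => normSign σ (r + p)) ?_ ?_
  · rintro r ⟨hσr, hvr, hrp, hrq⟩
    refine ⟨by rw [map_sub, map_mul, map_add, hσc, hσr, hσp], ?_, ?_, ?_⟩
    · rw [show c * (r + p) - p = c * r + (c - 1) * p by ring]; exact hkey r p hvr hp
    · rw [sub_add_cancel, map_mul, hc1, hrp, one_mul]
    · rw [show c * (r + p) - p + q = c * (r + q) + (c - 1) * (p - q) by ring]
      exact hkey _ _ hrq ((Valuation.map_sub _ _ _).trans (max_le hp hq))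
  · rintro r - r' -
    rw [show c * (r + p) - p - (c * (r' + p) - p) = c * (r - r') by ring, map_mul, hc1, one_mul]
  · rintro r ⟨hσr, -, hrp, -⟩ r' ⟨hσr', -, -, -⟩ hrr'
    have hx0 : r + p ≠ 0 := fun h0 => by rw [h0, map_zero] at hrp; exact zero_ne_one hrp
    refine (normSign_eq_of_rel_near hD (by rw [map_add, hσr, hσp]) (by rw [map_add, hσr', hσp]) hx0 hN ?_).symm
    rw [show r + p - (r' + p) = r - r' by ring, hrp, mul_one]; exact hrr'
  · rintro r ⟨hσr, -, hrp, -⟩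
    have hx0 : r + p ≠ 0 := fun h0 => by rw [h0, map_zero] at hrp; exact zero_ne_one hrp
    show normSign σ (c * (r + p) - p + p) = -normSign σ (r + p)
    rw [sub_add_cancel, normSign_mul_eq_neg_of_not_norm hD hσc hcn (by rw [map_add, hσr, hσp]) hx0]

/-! ## §2  The three slot sums over any system of `T = {σr = r, |r| = 1, |1 + r| = 1, |r + c₀| = 1}` -/

omit [Valued K ℤᵐ⁰] in
/-- `r·(r + c₀) = (1 + c₀r⁻¹)·(r·σr)` for fixed `r ≠ 0`. [cite: Serre1979, Ch. V §3 Cor. 3] -/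
theorem mul_add_eq_norm_mul {r : K} (hσr : σ r = r) (hr0 : r ≠ 0) (c₀ : K) : r * (r + c₀) = (1 + c₀ * r⁻¹) * (r * σ r) := by
  rw [hσr]; field_simp

omit [Valued K ℤᵐ⁰] in
/-- `(1 + r)·(r + c₀) = (1 − (1 − c₀)(1 + r)⁻¹)·((1 + r)·σ(1 + r))` for fixed `r` with `1 + r ≠ 0`. [cite: Serre1979, Ch. V §3 Cor. 3] -/
theorem one_add_mul_add_eq_norm_mul {r : K} (hσr : σ r = r) (hr1 : 1 + r ≠ 0) (c₀ : K) :
    (1 + r) * (r + c₀) = (1 - (1 - c₀) * (1 + r)⁻¹) * ((1 + r) * σ (1 + r)) := by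
  rw [map_add, map_one, hσr]; field_simp; ring

section Slots

variable [CompleteSpace K] [Finite 𝓀[K]] [DecidableEq K]

omit [DecidableEq K] in
/-- **SLOT 1 ON THE LOCUS: `Σ_{r ∈ Sh} ω(r + c₀) = 0`** over any complete irredundant system modulo `𝔭^N` of `T` (`2 ≤ d`, `2d − 1 ≤ N`; `c₀` fixed, `|c₀| ≤ 1`): §1 at `(p, q) = (c₀, 1)`.
[cite: Serre1979, Ch. V §3 Cor. 3; Ch. XV §2] -/
theorem sum_normSign_add_shell_eq_zero_locus (hD : IsRamifiedQuadraticDatum σ ϖ d t) (h2v : Valued.v (2 : K) < 1) (h2d : 2 ≤ d)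
    {N : ℕ} (hN : 2 * d - 1 ≤ N) {c₀ : K} (hσc₀ : σ c₀ = c₀) (hc₀ : Valued.v c₀ = 1)
    (Sh : Finset K) (hSh1 : ∀ r ∈ Sh, σ r = r ∧ Valued.v r = 1 ∧ Valued.v (1 + r) = 1 ∧ Valued.v (r + c₀) = 1)
    (hSh2 : ∀ r : K, σ r = r → Valued.v r = 1 → Valued.v (1 + r) = 1 → Valued.v (r + c₀) = 1 → ∃ x ∈ Sh, Valued.v (r - x) ≤ Valued.v ϖ ^ N)
    (hSh3 : ∀ x ∈ Sh, ∀ x' ∈ Sh, Valued.v (x - x') ≤ Valued.v ϖ ^ N → x = x') :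
    ∑ r ∈ Sh, normSign σ (r + c₀) = 0 :=
  sum_normSign_add_eq_zero_of_twoPoint hD h2v h2d hσc₀ hc₀.le (le_of_eq (map_one _)) hN Sh
    (fun r hr => by obtain ⟨h1, h2, h3, h4⟩ := hSh1 r hr; exact ⟨h1, h2, h4, by rw [add_comm]; exact h3⟩)
    (fun r h1 h2 h4 h3 => hSh2 r h1 h2 (by rw [add_comm]; exact h3) h4) hSh3

/-- **SLOT 0 ON THE LOCUS: `Σ_{r ∈ Sh} ω(r·(r + c₀)) = 0`** (same data, `σc₀ = c₀`, `|c₀| = 1`): `ω(r(r + c₀)) = ω(1 + c₀r⁻¹)`, `u = c₀r⁻¹` is a class-isometric involution of `T`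
(★ `image_repr`), and §1 at `(p, q) = (1, c₀)`. [cite: IrelandRosen1990, Ch. 8 §3] [cite: Serre1979, Ch. XV §2] -/
theorem sum_normSign_mul_add_shell_eq_zero_locus (hD : IsRamifiedQuadraticDatum σ ϖ d t) (h2v : Valued.v (2 : K) < 1) (h2d : 2 ≤ d)
    {N : ℕ} (hN : 2 * d - 1 ≤ N) {c₀ : K} (hσc₀ : σ c₀ = c₀) (hc₀ : Valued.v c₀ = 1)
    (Sh : Finset K) (hSh1 : ∀ r ∈ Sh, σ r = r ∧ Valued.v r = 1 ∧ Valued.v (1 + r) = 1 ∧ Valued.v (r + c₀) = 1)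
    (hSh2 : ∀ r : K, σ r = r → Valued.v r = 1 → Valued.v (1 + r) = 1 → Valued.v (r + c₀) = 1 → ∃ x ∈ Sh, Valued.v (r - x) ≤ Valued.v ϖ ^ N)
    (hSh3 : ∀ x ∈ Sh, ∀ x' ∈ Sh, Valued.v (x - x') ≤ Valued.v ϖ ^ N → x = x') :
    ∑ r ∈ Sh, normSign σ (r * (r + c₀)) = 0 := by
  have hu0 : ∀ x : K, Valued.v x = 1 → x ≠ 0 := fun x hx h0 => by rw [h0, map_zero] at hx; exact zero_ne_one hx
  -- letters of the involution `u = c₀·r⁻¹` on `T`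
  have hmap : ∀ r : K, σ r = r → Valued.v r = 1 → Valued.v (1 + r) = 1 → Valued.v (r + c₀) = 1 →
      σ (c₀ * r⁻¹) = c₀ * r⁻¹ ∧ Valued.v (c₀ * r⁻¹) = 1 ∧ Valued.v (c₀ * r⁻¹ + 1) = 1 ∧ Valued.v (c₀ * r⁻¹ + c₀) = 1 := by
    intro r hσr hvr h1r hrc
    have hr0 := hu0 r hvr
    refine ⟨by rw [map_mul, map_inv₀, hσc₀, hσr], by rw [map_mul, map_inv₀, hc₀, hvr, inv_one, mul_one], ?_, ?_⟩
    · rw [show c₀ * r⁻¹ + 1 = (r + c₀) * r⁻¹ by linear_combination (-1 : K) * mul_inv_cancel₀ hr0]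
      simp only [map_mul, map_inv₀, hrc, hvr, inv_one, mul_one]
    · rw [show c₀ * r⁻¹ + c₀ = c₀ * (1 + r) * r⁻¹ by linear_combination (-c₀) * mul_inv_cancel₀ hr0]
      simp only [map_mul, map_inv₀, hc₀, h1r, hvr, inv_one, mul_one]
  have hdist : ∀ r r' : K, Valued.v r = 1 → Valued.v r' = 1 → Valued.v (c₀ * r⁻¹ - c₀ * r'⁻¹) = Valued.v (r - r') := fun r r' hvr hvr' => by
    rw [show c₀ * r⁻¹ - c₀ * r'⁻¹ = c₀ * (r' - r) * (r⁻¹ * r'⁻¹) by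
      linear_combination (c₀ * r'⁻¹) * mul_inv_cancel₀ (hu0 r hvr) - (c₀ * r⁻¹) * mul_inv_cancel₀ (hu0 r' hvr')]
    simp only [map_mul, map_inv₀, hc₀, hvr, hvr', inv_one, one_mul, mul_one, Valuation.map_sub_swap Valued.v r' r]
  have hsurj : ∀ u ∈ {u : K | σ u = u ∧ Valued.v u = 1 ∧ Valued.v (u + 1) = 1 ∧ Valued.v (u + c₀) = 1},
      ∃ a ∈ {r : K | σ r = r ∧ Valued.v r = 1 ∧ Valued.v (1 + r) = 1 ∧ Valued.v (r + c₀) = 1}, Valued.v (u - c₀ * a⁻¹) ≤ Valued.v ϖ ^ N := by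
    rintro u ⟨hσu, hvu, hu1, huc⟩
    obtain ⟨h1, h2, h3, h4⟩ := hmap u hσu hvu (by rw [add_comm]; exact hu1) huc
    refine ⟨c₀ * u⁻¹, ⟨h1, h2, by rw [add_comm]; exact h3, h4⟩, ?_⟩
    rw [show c₀ * (c₀ * u⁻¹)⁻¹ = u by rw [mul_inv, inv_inv, ← mul_assoc, mul_inv_cancel₀ (hu0 c₀ hc₀), one_mul], sub_self, map_zero]; exact zero_le
  have hiso : ∀ a ∈ {r : K | σ r = r ∧ Valued.v r = 1 ∧ Valued.v (1 + r) = 1 ∧ Valued.v (r + c₀) = 1},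
      ∀ a' ∈ {r : K | σ r = r ∧ Valued.v r = 1 ∧ Valued.v (1 + r) = 1 ∧ Valued.v (r + c₀) = 1},
        Valued.v (c₀ * a⁻¹ - c₀ * a'⁻¹) ≤ Valued.v ϖ ^ N ↔ Valued.v (a - a') ≤ Valued.v ϖ ^ N := by
    rintro r ⟨-, hvr, -, -⟩ r' ⟨-, hvr', -, -⟩
    rw [hdist r r' hvr hvr']
  obtain ⟨hB1, hB2, hB3, hsum⟩ := image_repr (A := {r : K | σ r = r ∧ Valued.v r = 1 ∧ Valued.v (1 + r) = 1 ∧ Valued.v (r + c₀) = 1})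
    (B := {u : K | σ u = u ∧ Valued.v u = 1 ∧ Valued.v (u + 1) = 1 ∧ Valued.v (u + c₀) = 1}) (N := N) (N' := N) Sh hSh1
    (fun r hr => hSh2 r hr.1 hr.2.1 hr.2.2.1 hr.2.2.2) hSh3 (fun r => c₀ * r⁻¹) (fun r hr => hmap r hr.1 hr.2.1 hr.2.2.1 hr.2.2.2) hsurj hiso
    (fun u => normSign σ (u + 1))
  -- the summand is `ω(1 + c₀ r⁻¹)`
  have hterm : ∀ r ∈ Sh, normSign σ (r * (r + c₀)) = normSign σ (c₀ * r⁻¹ + 1) := fun r hr => by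
    obtain ⟨hσr, hvr, -, -⟩ := hSh1 r hr
    rw [mul_add_eq_norm_mul hσr (hu0 r hvr) c₀, normSign_mul_norm σ _ (hu0 r hvr), add_comm]
  rw [Finset.sum_congr rfl hterm, hsum]
  exact sum_normSign_add_eq_zero_of_twoPoint hD h2v h2d (map_one σ) (le_of_eq (map_one _)) hc₀.le hN _ hB1 (fun u h1 h2 h3 h4 => hB2 u ⟨h1, h2, h3, h4⟩) hB3

/-- **SLOT 2 ON THE LOCUS: `Σ_{r ∈ Sh} ω((1 + r)·(r + c₀)) = 0`** (same data with `|1 − c₀| = 1` in place of `|c₀| = 1`): `ω((1 + r)(r + c₀)) = ω(1 − (1 − c₀)(1 + r)⁻¹)`, `u = (1 − c₀)(1 + r)⁻¹` carries `T`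
class-isometrically onto `T(−1, −(1 − c₀))` (★ `image_repr`), `ω(1 − u) = ω(−1)·ω(u − 1)`, and §1 at `(p, q) = (−1, −(1 − c₀))`. [cite: Serre1979, Ch. V §3 Cor. 3; Ch. XV §2] -/
theorem sum_normSign_one_add_mul_add_shell_eq_zero_locus (hD : IsRamifiedQuadraticDatum σ ϖ d t) (h2v : Valued.v (2 : K) < 1) (h2d : 2 ≤ d)
    {N : ℕ} (hN : 2 * d - 1 ≤ N) {c₀ : K} (hσc₀ : σ c₀ = c₀) (h1c₀ : Valued.v (1 - c₀) = 1)
    (Sh : Finset K) (hSh1 : ∀ r ∈ Sh, σ r = r ∧ Valued.v r = 1 ∧ Valued.v (1 + r) = 1 ∧ Valued.v (r + c₀) = 1)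
    (hSh2 : ∀ r : K, σ r = r → Valued.v r = 1 → Valued.v (1 + r) = 1 → Valued.v (r + c₀) = 1 → ∃ x ∈ Sh, Valued.v (r - x) ≤ Valued.v ϖ ^ N)
    (hSh3 : ∀ x ∈ Sh, ∀ x' ∈ Sh, Valued.v (x - x') ≤ Valued.v ϖ ^ N → x = x') :
    ∑ r ∈ Sh, normSign σ ((1 + r) * (r + c₀)) = 0 := by
  have hu0 : ∀ x : K, Valued.v x = 1 → x ≠ 0 := fun x hx h0 => by rw [h0, map_zero] at hx; exact zero_ne_one hx
  have hc₁0 : (1 - c₀ : K) ≠ 0 := hu0 _ h1c₀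
  have hσc₁ : σ (1 - c₀) = 1 - c₀ := by rw [map_sub, map_one, hσc₀]
  have hσm1 : σ (-1 : K) = -1 := by rw [map_neg, map_one]
  -- letters of the transport `u = (1 − c₀)·(1 + r)⁻¹ : T → T(−1, −(1 − c₀))`
  have hmap : ∀ r : K, σ r = r → Valued.v r = 1 → Valued.v (1 + r) = 1 → Valued.v (r + c₀) = 1 →
      σ ((1 - c₀) * (1 + r)⁻¹) = (1 - c₀) * (1 + r)⁻¹ ∧ Valued.v ((1 - c₀) * (1 + r)⁻¹) = 1 ∧
        Valued.v ((1 - c₀) * (1 + r)⁻¹ + -1) = 1 ∧ Valued.v ((1 - c₀) * (1 + r)⁻¹ + -(1 - c₀)) = 1 := by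
    intro r hσr hvr h1r hrc
    have hr1 := hu0 _ h1r
    refine ⟨by rw [map_mul, map_inv₀, hσc₁, map_add, map_one, hσr], by rw [map_mul, map_inv₀, h1c₀, h1r, inv_one, mul_one], ?_, ?_⟩
    · rw [show (1 - c₀) * (1 + r)⁻¹ + -1 = -(r + c₀) * (1 + r)⁻¹ by linear_combination mul_inv_cancel₀ hr1]
      simp only [map_mul, map_inv₀, Valuation.map_neg, hrc, h1r, inv_one, mul_one]
    · rw [show (1 - c₀) * (1 + r)⁻¹ + -(1 - c₀) = -((1 - c₀) * r) * (1 + r)⁻¹ by linear_combination (1 - c₀) * mul_inv_cancel₀ hr1]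
      simp only [map_mul, map_inv₀, Valuation.map_neg, h1c₀, hvr, h1r, inv_one, mul_one]
  have hdist : ∀ r r' : K, Valued.v (1 + r) = 1 → Valued.v (1 + r') = 1 →
      Valued.v ((1 - c₀) * (1 + r)⁻¹ - (1 - c₀) * (1 + r')⁻¹) = Valued.v (r - r') := fun r r' h1r h1r' => by
    rw [show (1 - c₀) * (1 + r)⁻¹ - (1 - c₀) * (1 + r')⁻¹ = (1 - c₀) * (r' - r) * ((1 + r)⁻¹ * (1 + r')⁻¹) by
      linear_combination ((1 - c₀) * (1 + r')⁻¹) * mul_inv_cancel₀ (hu0 _ h1r) - ((1 - c₀) * (1 + r)⁻¹) * mul_inv_cancel₀ (hu0 _ h1r')]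
    simp only [map_mul, map_inv₀, h1c₀, h1r, h1r', inv_one, one_mul, mul_one, Valuation.map_sub_swap Valued.v r' r]
  have hsurj : ∀ u ∈ {u : K | σ u = u ∧ Valued.v u = 1 ∧ Valued.v (u + -1) = 1 ∧ Valued.v (u + -(1 - c₀)) = 1},
      ∃ a ∈ {r : K | σ r = r ∧ Valued.v r = 1 ∧ Valued.v (1 + r) = 1 ∧ Valued.v (r + c₀) = 1}, Valued.v (u - (1 - c₀) * (1 + a)⁻¹) ≤ Valued.v ϖ ^ N := by
    rintro u ⟨hσu, hvu, hu1, huc⟩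
    have huz := hu0 u hvu
    refine ⟨(1 - c₀) * u⁻¹ - 1, ⟨by rw [map_sub, map_one, map_mul, map_inv₀, hσc₁, hσu], ?_, ?_, ?_⟩, ?_⟩
    · rw [show (1 - c₀) * u⁻¹ - 1 = -(u + -(1 - c₀)) * u⁻¹ by linear_combination mul_inv_cancel₀ huz]
      simp only [map_mul, map_inv₀, Valuation.map_neg, huc, hvu, inv_one, mul_one]
    · rw [show 1 + ((1 - c₀) * u⁻¹ - 1) = (1 - c₀) * u⁻¹ by ring]
      simp only [map_mul, map_inv₀, h1c₀, hvu, inv_one, mul_one]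
    · rw [show (1 - c₀) * u⁻¹ - 1 + c₀ = -((1 - c₀) * (u + -1)) * u⁻¹ by linear_combination (1 - c₀) * mul_inv_cancel₀ huz]
      simp only [map_mul, map_inv₀, Valuation.map_neg, h1c₀, hu1, hvu, inv_one, mul_one]
    · rw [show 1 + ((1 - c₀) * u⁻¹ - 1) = (1 - c₀) * u⁻¹ by ring,
        show (1 - c₀) * ((1 - c₀) * u⁻¹)⁻¹ = u by rw [mul_inv, inv_inv, ← mul_assoc, mul_inv_cancel₀ hc₁0, one_mul], sub_self, map_zero]
      exact zero_le
  have hiso : ∀ a ∈ {r : K | σ r = r ∧ Valued.v r = 1 ∧ Valued.v (1 + r) = 1 ∧ Valued.v (r + c₀) = 1},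
      ∀ a' ∈ {r : K | σ r = r ∧ Valued.v r = 1 ∧ Valued.v (1 + r) = 1 ∧ Valued.v (r + c₀) = 1},
        Valued.v ((1 - c₀) * (1 + a)⁻¹ - (1 - c₀) * (1 + a')⁻¹) ≤ Valued.v ϖ ^ N ↔ Valued.v (a - a') ≤ Valued.v ϖ ^ N := by
    rintro r ⟨-, -, h1r, -⟩ r' ⟨-, -, h1r', -⟩
    rw [hdist r r' h1r h1r']
  obtain ⟨hB1, hB2, hB3, hsum⟩ := image_repr (A := {r : K | σ r = r ∧ Valued.v r = 1 ∧ Valued.v (1 + r) = 1 ∧ Valued.v (r + c₀) = 1})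
    (B := {u : K | σ u = u ∧ Valued.v u = 1 ∧ Valued.v (u + -1) = 1 ∧ Valued.v (u + -(1 - c₀)) = 1}) (N := N) (N' := N) Sh hSh1
    (fun r hr => hSh2 r hr.1 hr.2.1 hr.2.2.1 hr.2.2.2) hSh3 (fun r => (1 - c₀) * (1 + r)⁻¹) (fun r hr => hmap r hr.1 hr.2.1 hr.2.2.1 hr.2.2.2) hsurj hiso
    (fun u => normSign σ (1 - u))
  have hterm : ∀ r ∈ Sh, normSign σ ((1 + r) * (r + c₀)) = normSign σ (1 - (1 - c₀) * (1 + r)⁻¹) := fun r hr => by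
    obtain ⟨hσr, -, h1r, -⟩ := hSh1 r hr
    rw [one_add_mul_add_eq_norm_mul hσr (hu0 _ h1r) c₀, normSign_mul_norm σ _ (hu0 _ h1r)]
  -- `ω(1 − u) = ω(−1)·ω(u + (−1))`
  have hterm' : ∀ u ∈ Sh.image (fun r => (1 - c₀) * (1 + r)⁻¹), normSign σ (1 - u) = normSign σ (-1) * normSign σ (u + -1) := fun u hu => by
    obtain ⟨hσu, -, hu1, -⟩ := hB1 u hu
    rw [show (1 : K) - u = -1 * (u + -1) by ring, normSign_mul_of_fixed hD hσm1 (by rw [map_add, hσu, hσm1]) (by norm_num) (hu0 _ hu1)]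
  rw [Finset.sum_congr rfl hterm, hsum, Finset.sum_congr rfl hterm', ← Finset.mul_sum,
    sum_normSign_add_eq_zero_of_twoPoint hD h2v h2d hσm1 (by rw [Valuation.map_neg, map_one]) (by rw [Valuation.map_neg]; exact h1c₀.le) hN _ hB1
      (fun u h1 h2 h3 h4 => hB2 u ⟨h1, h2, h3, h4⟩) hB3, mul_zero]

end Slots

/-! ## §3  The `e = 0` linearisation `(g, b) ↦ g + (1+g)·b` of `R.filter cut ×ˢ B` onto a system of `T` -/

section Linearisation

variable [DecidableEq K]

/-- (a) THE IMAGE LIES IN `T`: `r = g + (1+g)b` is fixed, `|r| = |1 + r| = |r + c₀| = 1` (`g` a fixed unit in the cut, `|b| ≤ |ϖ|ⁿ`, `1 ≤ n`). [cite: Serre1979, Ch. II §1] -/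
theorem glueShell_image_sub_locus (hϖ : Valued.v ϖ = exp (-1 : ℤ)) {n : ℕ} (hn : 1 ≤ n) {c₀ : K}
    (R : Finset K) (hR1 : ∀ g ∈ R, σ g = g ∧ Valued.v g = 1) (B : Finset K) (hB1 : ∀ b ∈ B, σ b = b ∧ Valued.v b ≤ Valued.v ϖ ^ n) :
    ∀ r ∈ ((R.filter fun g => Valued.v (1 + g) = 1 ∧ Valued.v (g + c₀) = 1) ×ˢ B).image (fun p : K × K => p.1 + (1 + p.1) * p.2),
      σ r = r ∧ Valued.v r = 1 ∧ Valued.v (1 + r) = 1 ∧ Valued.v (r + c₀) = 1 := by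
  intro r hr
  obtain ⟨⟨g, b⟩, hgb, rfl⟩ := Finset.mem_image.1 hr
  obtain ⟨hg, hb⟩ := Finset.mem_product.1 hgb
  obtain ⟨hgR, h1g, hgc⟩ := Finset.mem_filter.1 hg
  obtain ⟨hσg, hvg⟩ := hR1 g hgR
  obtain ⟨hσb, hvb⟩ := hB1 b hb
  have hb1 : Valued.v b < 1 := lt_of_le_of_lt hvb (by rw [← pow_zero (Valued.v ϖ)]; exact (v_pow_lt_pow_iff hϖ _ _).2 (by omega))
  have hdeep : Valued.v ((1 + g) * b) < 1 := by rw [map_mul, h1g, one_mul]; exact hb1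
  refine ⟨by simp only [map_add, map_mul, map_one, hσg, hσb], by dsimp only; rw [Valuation.map_add_eq_of_lt_left _ (by rw [hvg]; exact hdeep), hvg], ?_, ?_⟩
  · dsimp only; rw [show 1 + (g + (1 + g) * b) = (1 + g) * (1 + b) by ring, map_mul, h1g, one_mul, Valued.v.map_one_add_of_lt hb1]
  · dsimp only; rw [show g + (1 + g) * b + c₀ = (g + c₀) + (1 + g) * b by ring, Valuation.map_add_eq_of_lt_left _ (by rw [hgc]; exact hdeep), hgc]

/-- (b) THE IMAGE IS COMPLETE modulo `𝔭^N` for `T` (`R` complete modulo `𝔭ⁿ` for the fixed units, `B` complete modulo `𝔭^N` for the fixed ball `|b| ≤ |ϖ|ⁿ`, `1 ≤ n`): the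
representative `g` of `r` inherits `|1 + g| = |g + c₀| = 1`. [cite: Serre1979, Ch. II §1] -/
theorem glueShell_image_complete_locus (hϖ : Valued.v ϖ = exp (-1 : ℤ)) {n N : ℕ} (hn : 1 ≤ n) {c₀ : K}
    (R : Finset K) (hR1 : ∀ g ∈ R, σ g = g ∧ Valued.v g = 1) (hR2 : ∀ f : K, σ f = f → Valued.v f = 1 → ∃ g ∈ R, Valued.v (f - g) ≤ Valued.v ϖ ^ n)
    (B : Finset K) (hB2 : ∀ b : K, σ b = b → Valued.v b ≤ Valued.v ϖ ^ n → ∃ b' ∈ B, Valued.v (b - b') ≤ Valued.v ϖ ^ N) :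
    ∀ r : K, σ r = r → Valued.v r = 1 → Valued.v (1 + r) = 1 → Valued.v (r + c₀) = 1 →
      ∃ x ∈ ((R.filter fun g => Valued.v (1 + g) = 1 ∧ Valued.v (g + c₀) = 1) ×ˢ B).image (fun p : K × K => p.1 + (1 + p.1) * p.2),
        Valued.v (r - x) ≤ Valued.v ϖ ^ N := by
  intro r hσr hvr h1r hrc
  obtain ⟨g, hgR, hrg⟩ := hR2 r hσr hvr
  obtain ⟨hσg, -⟩ := hR1 g hgR
  have hrg1 : Valued.v (r - g) < 1 := lt_of_le_of_lt hrg (by rw [← pow_zero (Valued.v ϖ)]; exact (v_pow_lt_pow_iff hϖ _ _).2 (by omega))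
  have h1g : Valued.v (1 + g) = 1 := by rw [show 1 + g = (1 + r) - (r - g) by ring, Valuation.map_sub_eq_of_lt_left _ (by rw [h1r]; exact hrg1), h1r]
  have hgc : Valued.v (g + c₀) = 1 := by rw [show g + c₀ = (r + c₀) - (r - g) by ring, Valuation.map_sub_eq_of_lt_left _ (by rw [hrc]; exact hrg1), hrc]
  have h1g0 : 1 + g ≠ 0 := fun h0 => by rw [h0, map_zero] at h1g; exact zero_ne_one h1g
  set b₀ : K := (r - g) / (1 + g) with hb₀
  have hσb₀ : σ b₀ = b₀ := by rw [hb₀, map_div₀, map_sub, map_add, map_one, hσr, hσg]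
  have hvb₀ : Valued.v b₀ ≤ Valued.v ϖ ^ n := by rw [hb₀, map_div₀, h1g, div_one]; exact hrg
  obtain ⟨b, hbB, hbb⟩ := hB2 b₀ hσb₀ hvb₀
  refine ⟨g + (1 + g) * b, Finset.mem_image.2 ⟨(g, b), Finset.mem_product.2 ⟨Finset.mem_filter.2 ⟨hgR, h1g, hgc⟩, hbB⟩, rfl⟩, ?_⟩
  rw [show r - (g + (1 + g) * b) = (1 + g) * (b₀ - b) by rw [hb₀]; field_simp; ring, map_mul, h1g, one_mul]; exact hbb

omit [DecidableEq K] in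
/-- (d) THE MAP IS INJECTIVE ON `R.filter cut ×ˢ B` (`1 ≤ n ≤ N`; `R` irredundant modulo `𝔭ⁿ`, `B` irredundant modulo `𝔭^N`). [cite: Serre1979, Ch. II §1] -/
theorem glueShell_injOn_locus (hϖ : Valued.v ϖ = exp (-1 : ℤ)) {n N : ℕ} (hn : 1 ≤ n) (hnN : n ≤ N) {c₀ : K}
    (R : Finset K) (hR3 : ∀ g ∈ R, ∀ g' ∈ R, Valued.v (g - g') ≤ Valued.v ϖ ^ n → g = g')
    (B : Finset K) (hB1 : ∀ b ∈ B, σ b = b ∧ Valued.v b ≤ Valued.v ϖ ^ n) (hB3 : ∀ b ∈ B, ∀ b' ∈ B, Valued.v (b - b') ≤ Valued.v ϖ ^ N → b = b') :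
    Set.InjOn (fun p : K × K => p.1 + (1 + p.1) * p.2) ↑((R.filter fun g => Valued.v (1 + g) = 1 ∧ Valued.v (g + c₀) = 1) ×ˢ B) := by
  rintro ⟨g, b⟩ hgb ⟨g', b'⟩ hgb' heq
  rw [Finset.mem_coe, Finset.mem_product] at hgb hgb'
  obtain ⟨hgR, h1g, -⟩ := Finset.mem_filter.1 hgb.1
  have hgR' := (Finset.mem_filter.1 hgb'.1).1
  have heq' : g + (1 + g) * b = g' + (1 + g') * b' := heq
  have hxx' : Valued.v ((g + (1 + g) * b) - (g' + (1 + g') * b')) ≤ Valued.v ϖ ^ N := by rw [heq', sub_self, map_zero]; exact zero_le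
  obtain ⟨hgg', hbb'⟩ := v_sub_le_and_of_v_linear_sub_le_unit hϖ hn hnN h1g (hB1 b hgb.2).2 (hB1 b' hgb'.2).2 hxx'
  have hgeq : g = g' := hR3 g hgR g' hgR' hgg'
  rw [hgeq, hB3 b hgb.2 b' hgb'.2 (hbb' hgeq)]

/-- (c) THE IMAGE IS IRREDUNDANT modulo `𝔭^N` (same data). [cite: Serre1979, Ch. II §1] -/
theorem glueShell_image_irredundant_locus (hϖ : Valued.v ϖ = exp (-1 : ℤ)) {n N : ℕ} (hn : 1 ≤ n) (hnN : n ≤ N) {c₀ : K}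
    (R : Finset K) (hR3 : ∀ g ∈ R, ∀ g' ∈ R, Valued.v (g - g') ≤ Valued.v ϖ ^ n → g = g')
    (B : Finset K) (hB1 : ∀ b ∈ B, σ b = b ∧ Valued.v b ≤ Valued.v ϖ ^ n) (hB3 : ∀ b ∈ B, ∀ b' ∈ B, Valued.v (b - b') ≤ Valued.v ϖ ^ N → b = b') :
    ∀ x ∈ ((R.filter fun g => Valued.v (1 + g) = 1 ∧ Valued.v (g + c₀) = 1) ×ˢ B).image (fun p : K × K => p.1 + (1 + p.1) * p.2),
      ∀ x' ∈ ((R.filter fun g => Valued.v (1 + g) = 1 ∧ Valued.v (g + c₀) = 1) ×ˢ B).image (fun p : K × K => p.1 + (1 + p.1) * p.2),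
        Valued.v (x - x') ≤ Valued.v ϖ ^ N → x = x' := by
  intro x hx x' hx' hxx'
  obtain ⟨⟨g, b⟩, hgb, rfl⟩ := Finset.mem_image.1 hx
  obtain ⟨⟨g', b'⟩, hgb', rfl⟩ := Finset.mem_image.1 hx'
  obtain ⟨hg, hb⟩ := Finset.mem_product.1 hgb
  obtain ⟨hg', hb'⟩ := Finset.mem_product.1 hgb'
  obtain ⟨hgR, h1g, -⟩ := Finset.mem_filter.1 hg
  have hgR' := (Finset.mem_filter.1 hg').1
  obtain ⟨hgg', hbb'⟩ := v_sub_le_and_of_v_linear_sub_le_unit hϖ hn hnN h1g (hB1 b hb).2 (hB1 b' hb').2 hxx'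
  have hgeq : g = g' := hR3 g hgR g' hgR' hgg'
  rw [hgeq, hB3 b hb b' hb' (hbb' hgeq)]

/-- (e) THE DOUBLE SUM IS A SINGLE SUM OVER THE IMAGE SYSTEM (`Finset.sum_product` + `Finset.sum_image` on (d)). [cite: Serre1979, Ch. II §1] -/
theorem sum_sum_glueShell_eq_sum_image_locus {M : Type} [AddCommMonoid M] (hϖ : Valued.v ϖ = exp (-1 : ℤ)) {n N : ℕ} (hn : 1 ≤ n) (hnN : n ≤ N) {c₀ : K}
    (R : Finset K) (hR3 : ∀ g ∈ R, ∀ g' ∈ R, Valued.v (g - g') ≤ Valued.v ϖ ^ n → g = g')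
    (B : Finset K) (hB1 : ∀ b ∈ B, σ b = b ∧ Valued.v b ≤ Valued.v ϖ ^ n) (hB3 : ∀ b ∈ B, ∀ b' ∈ B, Valued.v (b - b') ≤ Valued.v ϖ ^ N → b = b') (G : K → M) :
    ∑ g ∈ R.filter (fun g => Valued.v (1 + g) = 1 ∧ Valued.v (g + c₀) = 1), ∑ b ∈ B, G (g + (1 + g) * b) =
      ∑ r ∈ ((R.filter fun g => Valued.v (1 + g) = 1 ∧ Valued.v (g + c₀) = 1) ×ˢ B).image (fun p : K × K => p.1 + (1 + p.1) * p.2), G r := by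
  rw [Finset.sum_image (glueShell_injOn_locus (σ := σ) hϖ hn hnN R hR3 B hB1 hB3), Finset.sum_product]

/-- **THE LOCUS DOUBLE SUM OF A `T`-VANISHING SUMMAND VANISHES**: data `1 ≤ n ≤ 2M`, `2M ≤ k + d ≤ 2M + 1`, `d ≤ M ≤ k`; for any `G : K → ℤ` whose sum over EVERY complete
irredundant system modulo `𝔭^{2M}` of `T = {σr = r, |r| = 1, |1 + r| = 1, |r + c₀| = 1}` is `0`: `Σ_{g ∈ R.filter cut} Σ_{aβ ∈ Aβ} G(g + (1+g)(aβ − 1)) = 0`. [cite: Serre1979, Ch. II §1] -/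
theorem sum_filter_sum_eq_zero_of_shell_locus [CompleteSpace K] (hD : IsRamifiedQuadraticDatum σ ϖ d t)
    {n k M : ℕ} (hn : 1 ≤ n) (hnM : n ≤ 2 * M) (hMk : 2 * M ≤ k + d) (hkM : k + d ≤ 2 * M + 1) (hdM : d ≤ M) (hMk2 : M ≤ k)
    {c₀ : K} (R : Finset K) (hR1 : ∀ g ∈ R, σ g = g ∧ Valued.v g = 1)
    (hR2 : ∀ f : K, σ f = f → Valued.v f = 1 → ∃ g ∈ R, Valued.v (f - g) ≤ Valued.v ϖ ^ n)
    (hR3 : ∀ g ∈ R, ∀ g' ∈ R, Valued.v (g - g') ≤ Valued.v ϖ ^ n → g = g')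
    (Aβ : Finset K) (hAβsub : ∀ a ∈ Aβ, σ a = a ∧ Valued.v (a - 1) ≤ Valued.v ϖ ^ n)
    (hAβ : ∀ y : K, σ y = y → Valued.v (y - 1) ≤ Valued.v ϖ ^ n → ∃! a, a ∈ Aβ ∧ ∃ s : K, Valued.v (s - 1) ≤ Valued.v ϖ ^ k ∧ s * σ s = a / y)
    (G : K → ℤ)
    (hG : ∀ Sh : Finset K, (∀ r ∈ Sh, σ r = r ∧ Valued.v r = 1 ∧ Valued.v (1 + r) = 1 ∧ Valued.v (r + c₀) = 1) →
      (∀ r : K, σ r = r → Valued.v r = 1 → Valued.v (1 + r) = 1 → Valued.v (r + c₀) = 1 → ∃ x ∈ Sh, Valued.v (r - x) ≤ Valued.v ϖ ^ (2 * M)) →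
      (∀ x ∈ Sh, ∀ x' ∈ Sh, Valued.v (x - x') ≤ Valued.v ϖ ^ (2 * M) → x = x') → ∑ r ∈ Sh, G r = 0) :
    ∑ g ∈ R.filter (fun g => Valued.v (1 + g) = 1 ∧ Valued.v (g + c₀) = 1), ∑ a ∈ Aβ, G (g + (1 + g) * (a - 1)) = 0 := by
  obtain ⟨-, -, hϖ, -, -, -, -⟩ := id hD
  obtain ⟨hB1, hB2, hB3⟩ := image_sub_one_repr hD hn hMk hkM hdM hMk2 Aβ hAβsub hAβ
  have hinj : Set.InjOn (fun a : K => a - 1) ↑Aβ := fun a _ a' _ h => sub_left_injective h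
  have hinner : ∀ g : K, ∑ a ∈ Aβ, G (g + (1 + g) * (a - 1)) = ∑ b ∈ Aβ.image (fun a => a - 1), G (g + (1 + g) * b) := fun g => by rw [Finset.sum_image hinj]
  rw [Finset.sum_congr rfl fun g _ => hinner g, sum_sum_glueShell_eq_sum_image_locus (σ := σ) hϖ hn hnM R hR3 _ hB1 hB3 G]
  exact hG _ (glueShell_image_sub_locus hϖ hn R hR1 _ hB1) (glueShell_image_complete_locus hϖ hn R hR1 hR2 _ hB2)
    (glueShell_image_irredundant_locus hϖ hn hnM R hR3 _ hB1 hB3)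

end Linearisation

/-! ## §4  HEADS — the three locus double sums vanish -/

section Locus

variable [CompleteSpace K] [Finite 𝓀[K]] [DecidableEq K]

/-- **HEAD, SLOT 1 (LOCUS): `Σ_{g ∈ R, |1+g| = 1, |g+c₀| = 1} Σ_{aβ ∈ Aβ} ω((g + (1+g)(aβ − 1)) + c₀) = 0`** (`2 ≤ d`; `c₀` a fixed unit; `R` the fixed units modulo `𝔭ⁿ`;
data `1 ≤ n ≤ 2M`, `2d − 1 ≤ 2M`, `2M ≤ k + d ≤ 2M + 1`, `d ≤ M ≤ k`). [cite: Serre1979, Ch. V §3 Cor. 3; Ch. XV §2] -/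
theorem sum_filter_sum_normSign_add_eq_zero_locus (hD : IsRamifiedQuadraticDatum σ ϖ d t) (h2v : Valued.v (2 : K) < 1) (h2d : 2 ≤ d)
    {n k M : ℕ} (hn : 1 ≤ n) (hnM : n ≤ 2 * M) (hdM2 : 2 * d - 1 ≤ 2 * M) (hMk : 2 * M ≤ k + d) (hkM : k + d ≤ 2 * M + 1) (hdM : d ≤ M) (hMk2 : M ≤ k)
    {c₀ : K} (hσc₀ : σ c₀ = c₀) (hc₀ : Valued.v c₀ = 1) (R : Finset K) (hR1 : ∀ g ∈ R, σ g = g ∧ Valued.v g = 1)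
    (hR2 : ∀ f : K, σ f = f → Valued.v f = 1 → ∃ g ∈ R, Valued.v (f - g) ≤ Valued.v ϖ ^ n)
    (hR3 : ∀ g ∈ R, ∀ g' ∈ R, Valued.v (g - g') ≤ Valued.v ϖ ^ n → g = g')
    (Aβ : Finset K) (hAβsub : ∀ a ∈ Aβ, σ a = a ∧ Valued.v (a - 1) ≤ Valued.v ϖ ^ n)
    (hAβ : ∀ y : K, σ y = y → Valued.v (y - 1) ≤ Valued.v ϖ ^ n → ∃! a, a ∈ Aβ ∧ ∃ s : K, Valued.v (s - 1) ≤ Valued.v ϖ ^ k ∧ s * σ s = a / y) :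
    ∑ g ∈ R.filter (fun g => Valued.v (1 + g) = 1 ∧ Valued.v (g + c₀) = 1), ∑ a ∈ Aβ, normSign σ ((g + (1 + g) * (a - 1)) + c₀) = 0 :=
  sum_filter_sum_eq_zero_of_shell_locus hD hn hnM hMk hkM hdM hMk2 R hR1 hR2 hR3 Aβ hAβsub hAβ (fun r => normSign σ (r + c₀))
    (fun Sh h1 h2 h3 => sum_normSign_add_shell_eq_zero_locus hD h2v h2d hdM2 hσc₀ hc₀ Sh h1 h2 h3)

/-- **HEAD, SLOT 0 (LOCUS): `Σ_{g ∈ R, |1+g| = 1, |g+c₀| = 1} Σ_{aβ ∈ Aβ} ω(r·(r + c₀)) = 0`, `r = g + (1+g)(aβ − 1)`** (data as in slot 1). [cite: IrelandRosen1990, Ch. 8 §3]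
[cite: Serre1979, Ch. XV §2] -/
theorem sum_filter_sum_normSign_mul_add_eq_zero_locus (hD : IsRamifiedQuadraticDatum σ ϖ d t) (h2v : Valued.v (2 : K) < 1) (h2d : 2 ≤ d)
    {n k M : ℕ} (hn : 1 ≤ n) (hnM : n ≤ 2 * M) (hdM2 : 2 * d - 1 ≤ 2 * M) (hMk : 2 * M ≤ k + d) (hkM : k + d ≤ 2 * M + 1) (hdM : d ≤ M) (hMk2 : M ≤ k)
    {c₀ : K} (hσc₀ : σ c₀ = c₀) (hc₀ : Valued.v c₀ = 1) (R : Finset K) (hR1 : ∀ g ∈ R, σ g = g ∧ Valued.v g = 1)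
    (hR2 : ∀ f : K, σ f = f → Valued.v f = 1 → ∃ g ∈ R, Valued.v (f - g) ≤ Valued.v ϖ ^ n)
    (hR3 : ∀ g ∈ R, ∀ g' ∈ R, Valued.v (g - g') ≤ Valued.v ϖ ^ n → g = g')
    (Aβ : Finset K) (hAβsub : ∀ a ∈ Aβ, σ a = a ∧ Valued.v (a - 1) ≤ Valued.v ϖ ^ n)
    (hAβ : ∀ y : K, σ y = y → Valued.v (y - 1) ≤ Valued.v ϖ ^ n → ∃! a, a ∈ Aβ ∧ ∃ s : K, Valued.v (s - 1) ≤ Valued.v ϖ ^ k ∧ s * σ s = a / y) :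
    ∑ g ∈ R.filter (fun g => Valued.v (1 + g) = 1 ∧ Valued.v (g + c₀) = 1), ∑ a ∈ Aβ,
      normSign σ ((g + (1 + g) * (a - 1)) * ((g + (1 + g) * (a - 1)) + c₀)) = 0 :=
  sum_filter_sum_eq_zero_of_shell_locus hD hn hnM hMk hkM hdM hMk2 R hR1 hR2 hR3 Aβ hAβsub hAβ (fun r => normSign σ (r * (r + c₀)))
    (fun Sh h1 h2 h3 => sum_normSign_mul_add_shell_eq_zero_locus hD h2v h2d hdM2 hσc₀ hc₀ Sh h1 h2 h3)

/-- **HEAD, SLOT 2 (LOCUS): `Σ_{g ∈ R, |1+g| = 1, |g+c₀| = 1} Σ_{aβ ∈ Aβ} ω((1 + r)·(r + c₀)) = 0`, `r = g + (1+g)(aβ − 1)`** (data as in slot 1 with `h1c₀ : |1 − c₀| = 1` in place of `hc₀`).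
[cite: Serre1979, Ch. V §3 Cor. 3; Ch. XV §2] -/
theorem sum_filter_sum_normSign_one_add_mul_add_eq_zero_locus (hD : IsRamifiedQuadraticDatum σ ϖ d t) (h2v : Valued.v (2 : K) < 1) (h2d : 2 ≤ d)
    {n k M : ℕ} (hn : 1 ≤ n) (hnM : n ≤ 2 * M) (hdM2 : 2 * d - 1 ≤ 2 * M) (hMk : 2 * M ≤ k + d) (hkM : k + d ≤ 2 * M + 1) (hdM : d ≤ M) (hMk2 : M ≤ k)
    {c₀ : K} (hσc₀ : σ c₀ = c₀) (h1c₀ : Valued.v (1 - c₀) = 1) (R : Finset K) (hR1 : ∀ g ∈ R, σ g = g ∧ Valued.v g = 1)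
    (hR2 : ∀ f : K, σ f = f → Valued.v f = 1 → ∃ g ∈ R, Valued.v (f - g) ≤ Valued.v ϖ ^ n)
    (hR3 : ∀ g ∈ R, ∀ g' ∈ R, Valued.v (g - g') ≤ Valued.v ϖ ^ n → g = g')
    (Aβ : Finset K) (hAβsub : ∀ a ∈ Aβ, σ a = a ∧ Valued.v (a - 1) ≤ Valued.v ϖ ^ n)
    (hAβ : ∀ y : K, σ y = y → Valued.v (y - 1) ≤ Valued.v ϖ ^ n → ∃! a, a ∈ Aβ ∧ ∃ s : K, Valued.v (s - 1) ≤ Valued.v ϖ ^ k ∧ s * σ s = a / y) :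
    ∑ g ∈ R.filter (fun g => Valued.v (1 + g) = 1 ∧ Valued.v (g + c₀) = 1), ∑ a ∈ Aβ,
      normSign σ ((1 + (g + (1 + g) * (a - 1))) * ((g + (1 + g) * (a - 1)) + c₀)) = 0 :=
  sum_filter_sum_eq_zero_of_shell_locus hD hn hnM hMk hkM hdM hMk2 R hR1 hR2 hR3 Aβ hAβsub hAβ (fun r => normSign σ ((1 + r) * (r + c₀)))
    (fun Sh h1 h2 h3 => sum_normSign_one_add_mul_add_shell_eq_zero_locus hD h2v h2d hdM2 hσc₀ h1c₀ Sh h1 h2 h3)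

end Locus

end Summit.HodgeConjecture.HodgeConjecture.Cruxes.H413.F0P3cDyRamGlueWindowVanishingLocus
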